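import Mathlib
import Summits.KontsevichZagierPeriods.Zeta5Search.RecordRayCell1314
import HarnessLib

/-!
# ζ(5) search — the record ray's cell `11n < p < 12n`: every class has `E_x ≥ −5`, `casLB ≥ −7` (sharp), `N_p = 15`, and the PATH node there

Cell `pub-zeta5` (HONEST FRAMING: systematic search; no irrationality claim unless certified), TRACK «DENOM-LAW» D1 prover seat
(denom-prover-d1 g11, `HOME/denom-law/prover-d1/ATTEMPT-11.md` §8).  On Brown–Zudilin's record ray `b(n) = n·(41;17,…,11)` and `11n < p < 12n` every
class has three or four points (`x + 2p < 36n ≤ 41n` always; `x + 3p ≤ 41n` iff `x ≤ 41n − 3p`; `x + 4p > 41n`), and the depth bookkeeping of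
`RecordRayDominanceProof` §1 gives `E_x ≥ −5` for EVERY class (sharp), hence `casLB(b(n),p) ≥ −7` (`VB ≥ −5`, rows `≥ −2`; the census value) and, by
THEOREM LB, `v_p(Cas_j(b(n))) ≥ −7`.  Here `⌊d/p⌋ = 2`, `N_p = 15` and `C⋆ ≤ 11` (trivially), so the PATH ACCOUNTING node's value is
`2 − 15 − min(1, 5 − C⋆) ≤ −7`: `PathAccountingFirstPeriod`'s literal conclusion holds on this cell (`pathAccounting_bRec_cell1112`).
Integer bookkeeping; nothing about irrationality.
-/

open Finset

namespace Summit.KontsevichZagierPeriods.Zeta5Search.RecordRay1112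

open Summit.KontsevichZagierPeriods.Zeta5Search.ClusterValuation
open Summit.KontsevichZagierPeriods.Zeta5Search.CasoratianValuation (InPolytope pairFloors refund shift casoratian)
open Summit.KontsevichZagierPeriods.Zeta5Search.WedgeDictionary (dOf)
open Summit.KontsevichZagierPeriods.Zeta5Search.CellA
open Summit.KontsevichZagierPeriods.Zeta5Search.RecordRayTop (self_mem_class add_mem_class)
open Summit.KontsevichZagierPeriods.Zeta5Search.RecordRayMid14 (dep7_le_low dep7_le_high netExp_ge mem2 classExp_ge_sub)
open Summit.KontsevichZagierPeriods.Zeta5Search.DenomLaw (cStar)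
open Summit.KontsevichZagierPeriods.Zeta5Search.DenomLaw.FirstPeriodKit (cStar_le_eleven)

section Cell

variable {n p x : ℕ} (hp11 : 11 * n < p) (hp12 : p < 12 * n) (hx : x < p)

include hp11 hx in
/-- The class of `x`: its points among `x + kp`, `k ≤ 3` (`x + 4p > 44n > 41n`). -/
theorem mem_class_cases4' {s : ℕ} (hs : s ∈ classSet (bRec n) p x) :
    s = x ∨ s = x + p ∨ s = x + 2 * p ∨ (s = x + 3 * p ∧ x + 3 * p ≤ 41 * n) := by
  rw [mem_classSet_iff, bRec_zero_toNat] at hs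
  obtain ⟨hs41, k, hk⟩ := hs
  have hk0 : 0 ≤ k := by
    by_contra hneg
    push Not at hneg
    have : (p : ℤ) * k ≤ (p : ℤ) * (-1) := mul_le_mul_of_nonneg_left (by omega) (by omega)
    omega
  have hk4 : k < 4 := by
    by_contra hge
    push Not at hge
    have : (p : ℤ) * 4 ≤ (p : ℤ) * k := mul_le_mul_of_nonneg_left hge (by omega)
    omega
  interval_cases k
  · left; omega
  · right; left; omega
  · right; right; left; omega
  · right; right; right; constructor <;> omega

/-- `x + 3p` lies in the class when `≤ 41n`. -/
theorem mem3 (h : x + 3 * p ≤ 41 * n) : x + 3 * p ∈ classSet (bRec n) p x := by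
  rw [mem_classSet_iff, bRec_zero_toNat]; exact ⟨h, 3, by push_cast; ring⟩

omit hp11 hp12 hx in
/-- **Every class has `E_x ≥ −5` on the cell `11n < p < 12n`** (the cell hypotheses are explicit binders here: the landed
`RecordRayMid14.classExp_ge_neg5` is the DIFFERENT cell `12n < p < 14n` with the same conclusion shape — not reusable on this cell). -/
theorem classExp_ge_neg5_cell1112 (hp11 : 11 * n < p) (hp12 : p < 12 * n) (hx : x < p) : (-5 : ℤ) ≤ classExp (bRec n) p x := by
  have hv41 : x + p ≤ 41 * n := by omega
  have hw41 : x + 2 * p ≤ 41 * n := by omega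
  have gx := netExp_ge n x
  have gv := netExp_ge n (x + p)
  have gw := netExp_ge n (x + 2 * p)
  have d1le := dep7_le n (x + p)
  -- the three sure points
  have hsub3 : ({x, x + p, x + 2 * p} : Finset ℕ) ⊆ classSet (bRec n) p x := by
    intro s hs
    simp only [mem_insert, mem_singleton] at hs
    rcases hs with rfl | rfl | rfl
    · exact self_mem_class (by omega) hx
    · exact add_mem_class hv41
    · exact mem2 hw41
  by_cases hu : x + 3 * p ≤ 41 * n
  · -- four points: `x < 8n` (depth 0), `x + 3p > 33n` (a zero worth `+1`), and `d₁ + d₂ ≤ 9`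
    have gu := netExp_ge n (x + 3 * p)
    have e0 : dep7 n x = 0 := dep7_low (by omega)
    have e3 : dep7 n (x + 3 * p) = 0 := dep7_high (by omega)
    have hsub : ({x, x + p, x + 2 * p, x + 3 * p} : Finset ℕ) ⊆ classSet (bRec n) p x := by
      intro s hs
      rw [mem_insert] at hs
      rcases hs with rfl | hs
      · exact self_mem_class (by omega) hx
      rw [mem_insert] at hs
      rcases hs with rfl | hs
      · exact add_mem_class hv41
      rw [mem_insert, mem_singleton] at hs
      rcases hs with rfl | rfl
      · exact mem2 hw41
      · exact mem3 hu
    have hrest : ∀ s ∈ classSet (bRec n) p x, s ∉ ({x, x + p, x + 2 * p, x + 3 * p} : Finset ℕ) → 0 ≤ netExp (bRec n) s := by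
      intro s hs hns
      rcases mem_class_cases4' hp11 hx hs with rfl | rfl | rfl | ⟨rfl, -⟩ <;> simp at hns
    have hE := classExp_ge_sub ({x, x + p, x + 2 * p, x + 3 * p} : Finset ℕ) hsub hrest
    rw [sum_insert (by simp; omega), sum_insert (by simp; omega), sum_pair (by omega)] at hE
    have h9 : dep7 n (x + p) + dep7 n (x + 2 * p) ≤ 9 := by
      by_cases h1 : x + p < 12 * n
      · have := dep7_le_low (n := n) (q := x + p) (k := 1) (by norm_num) (by omega)
        have := dep7_le n (x + 2 * p)
        omega
      by_cases h2 : x + p < 13 * n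
      · have := dep7_le_low (n := n) (q := x + p) (k := 2) (by norm_num) (by omega)
        have := dep7_le n (x + 2 * p)
        omega
      by_cases h3 : x + p < 14 * n
      · have := dep7_le_low (n := n) (q := x + p) (k := 3) (by norm_num) (by omega)
        have := dep7_le_high (n := n) (q := x + 2 * p) (k := 6) (by norm_num) (by omega)
        omega
      by_cases h4 : x + p < 15 * n
      · have := dep7_le_low (n := n) (q := x + p) (k := 4) (by norm_num) (by omega)
        have := dep7_le_high (n := n) (q := x + 2 * p) (k := 5) (by norm_num) (by omega)
        omega
      by_cases h5 : x + p < 16 * n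
      · have := dep7_le_low (n := n) (q := x + p) (k := 5) (by norm_num) (by omega)
        have := dep7_le_high (n := n) (q := x + 2 * p) (k := 4) (by norm_num) (by omega)
        omega
      by_cases h6 : x + p < 17 * n
      · have := dep7_le_low (n := n) (q := x + p) (k := 6) (by norm_num) (by omega)
        have := dep7_le_high (n := n) (q := x + 2 * p) (k := 3) (by norm_num) (by omega)
        omega
      · have := dep7_le_high (n := n) (q := x + 2 * p) (k := 2) (by norm_num) (by omega)
        omega
    have : ((dep7 n (x + p) : ℕ) : ℤ) + ((dep7 n (x + 2 * p) : ℕ) : ℤ) ≤ 9 := by exact_mod_cast h9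
    rw [e0] at gx
    rw [e3] at gu
    push_cast at gx gu
    linarith
  · -- three points: `x + p > 41n − 2p > 17n` has depth ≤ 7, `x + 2p > 41n − p > 29n`; if `x ≥ 11n` then `x + 2p > 33n` is a zero
    push Not at hu
    have hrest : ∀ s ∈ classSet (bRec n) p x, s ∉ ({x, x + p, x + 2 * p} : Finset ℕ) → 0 ≤ netExp (bRec n) s := by
      intro s hs hns
      rcases mem_class_cases4' hp11 hx hs with rfl | rfl | rfl | ⟨rfl, h3⟩
      · simp at hns
      · simp at hns
      · simp at hns
      · omega
    have hE := classExp_ge_sub ({x, x + p, x + 2 * p} : Finset ℕ) hsub3 hrest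
    rw [sum_insert (by simp; omega), sum_pair (by omega)] at hE
    have : ((dep7 n (x + p) : ℕ) : ℤ) ≤ 7 := by exact_mod_cast d1le
    by_cases hx11 : x < 11 * n
    · have e0 : dep7 n x = 0 := dep7_low hx11
      have e2 := dep7_le_high (n := n) (q := x + 2 * p) (k := 1) (by norm_num) (by omega)
      have : ((dep7 n (x + 2 * p) : ℕ) : ℤ) ≤ 1 := by exact_mod_cast e2
      rw [e0] at gx
      push_cast at gx
      linarith
    · have e0 := dep7_le_low (n := n) (q := x) (k := 1) (by norm_num) (by omega)
      have e2 : dep7 n (x + 2 * p) = 0 := dep7_high (by omega)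
      have : ((dep7 n x : ℕ) : ℤ) ≤ 1 := by exact_mod_cast e0
      rw [e2] at gw
      push_cast at gw
      linarith

end Cell

/-- **`casLB(b(n),p) ≥ −7`** for `11n < p < 12n` (`VB ≥ −5`, rows `≥ −2`; the census value of the cell). -/
theorem casLB_ge1112 {n p : ℕ} (hp11 : 11 * n < p) (hp12 : p < 12 * n) : -7 ≤ casLB (bRec n) p := by
  rcases casLB_ge_or_noPole (bRec n) p (-5) (-2)
      (fun x hx _ => (classExp_ge_neg5_cell1112 hp11 hp12 hx).trans (classExp_le_classNu _ _ _)) (by norm_num)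
      (fun x hx _ => by linarith [classExp_ge_neg5_cell1112 hp11 hp12 hx]) (fun _ => by norm_num) with ⟨h0, -⟩ | h
  · rw [h0]; norm_num
  · linarith

/-- **`v_p(Cas_j(b(n))) ≥ −7`** on `11n < p < 12n` (THEOREM LB). -/
theorem cas_ge_neg7 (n j p : ℕ) (hn : 1 ≤ n) (hj1 : 1 ≤ j) (hj7 : j ≤ 7) (hprime : p.Prime) (hp11 : 11 * n < p) (hp12 : p < 12 * n)
    (hwin : (41 * n + 2 : ℤ) < (p : ℤ) ^ 2) (hcas : casoratian (bRec n) j ≠ 0) :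
    (-7 : ℤ) ≤ padicValRat p (casoratian (bRec n) j) := by
  have hb0 : (bRec n 0 + 2 : ℤ) < (p : ℤ) ^ 2 := by rw [bRec_zero]; exact_mod_cast hwin
  have h := casoratianClassBound_holds (bRec n) j p (inPolytope_bRec n) hj1 hj7
    (inPolytope_shift_bRec n j hn hj1 hj7) hprime (by omega) hb0 hcas
  linarith [casLB_ge1112 hp11 hp12]

/-- **`N_p(b(n)) = 15`** for `11n < p ≤ 12n` (pair blocks `c·n`, `c = 12,…,18`, counted `3,3,3,2,2,1,1` times, each exactly once; `c ≤ 11` below `p`). -/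
theorem pairFloors_bRec_1112 {n p : ℕ} (hp11 : 11 * n < p) (hp12 : p ≤ 12 * n) : pairFloors (bRec n) p = 15 := by
  have hp0 : (0 : ℤ) < p := by exact_mod_cast (show 0 < p by omega)
  have hq0 : ∀ (a b : ℤ), 0 ≤ (n : ℤ) * 41 - (n : ℤ) * a - (n : ℤ) * b → (n : ℤ) * 41 - (n : ℤ) * a - (n : ℤ) * b < p →
      ((n : ℤ) * 41 - (n : ℤ) * a - (n : ℤ) * b) / (p : ℤ) = 0 := fun a b h0 h1 => Int.ediv_eq_zero_of_lt h0 h1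
  have hq1 : ∀ (a b : ℤ), (p : ℤ) ≤ (n : ℤ) * 41 - (n : ℤ) * a - (n : ℤ) * b → (n : ℤ) * 41 - (n : ℤ) * a - (n : ℤ) * b < 2 * p →
      ((n : ℤ) * 41 - (n : ℤ) * a - (n : ℤ) * b) / (p : ℤ) = 1 := by
    intro a b h1 h2
    rw [Int.ediv_eq_iff_of_pos hp0]; constructor <;> omega
  unfold pairFloors
  simp only [sum_range_succ, sum_range_zero, bRec]
  norm_num
  rw [hq0 17 16 (by omega) (by omega),
      hq0 17 15 (by omega) (by omega),
      hq0 17 14 (by omega) (by omega),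
      hq0 17 13 (by omega) (by omega),
      hq0 16 15 (by omega) (by omega),
      hq0 16 14 (by omega) (by omega),
      hq1 17 12 (by omega) (by omega),
      hq1 17 11 (by omega) (by omega),
      hq1 16 13 (by omega) (by omega),
      hq1 16 12 (by omega) (by omega),
      hq1 16 11 (by omega) (by omega),
      hq1 15 14 (by omega) (by omega),
      hq1 15 13 (by omega) (by omega),
      hq1 15 12 (by omega) (by omega),
      hq1 15 11 (by omega) (by omega),
      hq1 14 13 (by omega) (by omega),
      hq1 14 12 (by omega) (by omega),
      hq1 14 11 (by omega) (by omega),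
      hq1 13 12 (by omega) (by omega),
      hq1 13 11 (by omega) (by omega),
      hq1 12 11 (by omega) (by omega)]
  norm_num

/-- **PATH on the record cell `11n < p < 12n`**: `⌊d/p⌋ = 2`, `N_p = 15`, `C⋆ ≤ 11`, so the node's value is `≤ 2 − 15 + 6 = −7 ≤ casLB ≤ v_p(Cas₇)`. -/
theorem pathAccounting_bRec_cell1112 (n p : ℕ) (hn : 1 ≤ n) (hprime : p.Prime) (hp11 : 11 * n < p) (hp12 : p < 12 * n)
    (hwin : (41 * n + 2 : ℤ) < (p : ℤ) ^ 2) (hcas : casoratian (bRec n) 7 ≠ 0) :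
    dOf (bRec n) / (p : ℤ) - pairFloors (bRec n) p
        - min (if 2 ≤ dOf (bRec n) / (p : ℤ) then (1 : ℤ) else 0) (5 - (cStar (bRec n) p : ℤ))
      ≤ padicValRat p (casoratian (bRec n) 7) := by
  have hv := cas_ge_neg7 n 7 p hn (by norm_num) (by norm_num) hprime hp11 hp12 hwin hcas
  have hC : (cStar (bRec n) p : ℤ) ≤ 11 := by exact_mod_cast cStar_le_eleven (bRec n) p
  have hp0 : (0 : ℤ) < p := by exact_mod_cast hprime.pos
  have hfd : dOf (bRec n) / (p : ℤ) = 2 := by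
    rw [dOf_bRec]
    apply le_antisymm
    · have : (25 * (n : ℤ)) / (p : ℤ) < 3 := by rw [Int.ediv_lt_iff_lt_mul hp0]; omega
      omega
    · rw [Int.le_ediv_iff_mul_le hp0]; omega
  rw [hfd, if_pos (le_refl _), pairFloors_bRec_1112 hp11 (by omega)]
  have hmin : -6 ≤ min (1 : ℤ) (5 - (cStar (bRec n) p : ℤ)) := le_min (by norm_num) (by linarith)
  linarith

end Summit.KontsevichZagierPeriods.Zeta5Search.RecordRay1112
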